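import Literature.NumberTheory.Rogawski1990.AdelicStableOrbitalCentralH
import Literature.NumberTheory.Automorphic.UnitaryGroupOrbitalMeasureFamilyOfLocal
import HarnessLib

/-!
# The mass of `AdelicOrbitalMeasureFamily.ofLocal mG mGi` at a rational class with CENTRAL representative: a FINITE product of local masses,
# hence `1` when the central members are probability measures — the (CEN) clause of the singular elliptic transfer package
(Rogawski, *Automorphic Representations of Unitary Groups in Three Variables* (1990), §5.4 pp. 72–73 (5.4.3); Prop. 10.1.2 (b) p. 146: at a central
class `γ = ζ·1` the contribution is `m(Z G∖G) f(γ)` — the orbit space is ONE point; Deitmar–Echterhoff (2014), Thm. 1.5.3)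

Topic `NumberTheory/Rogawski1990`; namespaces `Literature.NumberTheory.Automorphic.UnitaryGroup` (§1: any `N`, `H`, class with central representative) and
`Literature.NumberTheory.Rogawski1990` (§2: the scalar rational classes `ζ • 1`).  THEOREMS ONLY (no definition, no instance, no notation, no named fact,
no `sorry`).  Cell `pub/hodgecm-mathlib`, FLOOR-0 programme P3a, the «#88 side» (pay-down of ★ `Rogawski1990.SingularEllipticTransferCanonical`, LEAD DESK
WORD T6-18, tree `F0/P3a/T6e-TREE.md` (T3)): the `G′`-side TWIN of ★ `UnitaryGroup.classOrbitalIntegral_ofLocalAdelicPair_of_forall_comm`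
(★ `OrbitalMeasureCentralMass` §2, the pair `H = U(H₂) × U(H₁)`), for the class-indexed adelic family ★ `AdelicOrbitalMeasureFamily.ofLocal L N H mG mGi`
of ONE unitary group `U(H)` — the family the (CEN) clause of ★ `SingularEllipticTransfer[Canonical]` reads:
`∀ c, (∃ ζ, (out c : Matrix) = ζ • 1) → AdelicOrbitalMeasureFamily.ofLocal L 3 H′ mGs mGis c univ = 1`.

* §1 (generic `U(H)`, class `c` of `U(H)(L⁺)` whose adelic representative `γ = (out c) ⊗ 1` is central in `U(H)(𝔸)` with central local components `γ_v`;
  local members admissible at `⟦γ_v⟧` and normalised off `S₀` (★ `IsNormalisedOff`), archimedean member admissible at `⟦γ_∞⟧` — the binders of ★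
  `adelicClassOrbitalIntegral_ofLocal_eval_eq_mul_prod` VERBATIM):
  `atPoint_toLocal_univ_eq_one_of_forall_comm` (off `S₀` the one-point local orbit space has mass `1`: the image of `U(H)(𝒪_v)` is everything);
  **`adelicClassOrbitalIntegral_ofLocal_of_forall_comm`**:
  `adelicClassOrbitalIntegral (ofLocal mG mGi) F c = (mGi.atPoint γ_∞ univ).toReal · (∏_{v ∈ S₀} ((mG v).atPoint γ_v univ).toReal) · F γ` for EVERY `F`
  (★ `ofLocal_eq`, ★ `adelicOrbitalMeasureOfLocal_spec` at `1 ⊗ 1`, ★ `finAdelicOrbitalMeasureOfLocal_spec` at `f_v ≡ 1`, §1 of ★ `OrbitalMeasureCentralMass`);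
  the MEASURE statements **`ofLocal_apply_univ_of_forall_comm`** (`(ofLocal mG mGi c univ).toReal = (mGi.atPoint γ_∞ univ).toReal · ∏_{v ∈ S₀} (…).toReal`) and
  **`ofLocal_univ_eq_one_of_forall_comm`** (mass-one central members ⇒ `ofLocal mG mGi c univ = 1`; the orbit space is one point, hence compact, so the
  admissible `ofLocal mG mGi c` is a finite measure and `toReal` is faithful).
* §2 (the scalar classes): for `c` with `((out c).val : Matrix) = ζ • 1` the representative, its local components and its archimedean component are
  central (★ `cmDatum_toAdelic_comm_of_smul_one`, ★ `cmDatum_toLocal_toAdelic_comm_of_smul_one`, ★ `cmRationalToArch_comm_of_smul_one`, ★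
  `archPart_cmDatum_toAdelic`), so **`ofLocal_univ_eq_one_of_eq_smul_one`** gives the (CEN) clause :219 of ★ `SingularEllipticTransfer` for ANY members
  `(mGs, mGis)` that are admissible and normalised off a finite set at the scalar classes with probability members there (what every constructor of the
  singular members — Dirac masses at the central classes, ★ `exists_smulInvariantMeasure_quotient_centralizer_of_forall_comm_top` — delivers), and
  `adelicClassOrbitalIntegral_ofLocal_of_eq_smul_one` gives `Φ(ζ·1, F) = (masses) · F(ζ·1 ⊗ 1)`.
* §3 (ED. 2, append-only; T6-L5 draft v1 88621e78's P2 stub carries NO admissibility hypothesis): at a central class admissibility FOLLOWS from mass one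
  (`smulInvariantMeasure_quotient_centralizer_of_forall_comm`, `OrbitalMeasureFamily.admissible_mk_of_atPoint_univ_eq_one_of_forall_comm` — one-point orbit
  space, `Subsingleton.measurable`), hence **`ofLocal_univ_eq_one_of_eq_smul_one_of_atPoint_univ_eq_one`**: (CEN) from `(hζ, (NORM) hS₀, (C1) h1 h1A)` alone.
HC_CM is proved only modulo the printed citations until rung 0 closes; this file proves no printed citation (measure plumbing at the central classes).

## References
* J. D. Rogawski, *Automorphic Representations of Unitary Groups in Three Variables*, Ann. of Math. Stud. 123 (1990), §5.4 (5.4.3) pp. 72–73,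
  Prop. 10.1.2 (b) p. 146, §14.5 p. 238 [Rogawski1990].
* A. Deitmar, S. Echterhoff, *Principles of Harmonic Analysis*, 2nd ed. (2014), Thm. 1.5.3 [DeitmarEchterhoff2014].
* S. Gelbart, *Automorphic forms on adele groups*, Ann. of Math. Stud. 83 (1975), p. 155 (10.19) [Gelbart1975].
-/

set_option autoImplicit false

noncomputable section

open MeasureTheory Measure Set Filter Topology NumberField IsDedekindDomain
open Literature.MeasureTheory.Group
open scoped ENNReal MatrixGroups

namespace Literature.NumberTheory.Automorphic

namespace UnitaryGroup

/-! ## §1 The mass of `ofLocal mG mGi` at a class with central representative: a finite product of local masses -/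

section CentralOfLocal

variable (L : Type) [Field L] [NumberField L] [IsCMField L] (N : ℕ) (H : Matrix (Fin N) (Fin N) L)
  [∀ g : (cmDatum L N H).Adelic, MeasurableSpace ((cmDatum L N H).Adelic ⧸ Subgroup.centralizer ({g} : Set (cmDatum L N H).Adelic))]
  [∀ a : arch (↥(maximalRealSubfield L)) L (IsCMField.complexConj L) N H,
    MeasurableSpace (arch (↥(maximalRealSubfield L)) L (IsCMField.complexConj L) N H ⧸
      Subgroup.centralizer ({a} : Set (arch (↥(maximalRealSubfield L)) L (IsCMField.complexConj L) N H)))]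
  [∀ (v : HeightOneSpectrum (𝓞 ↥(maximalRealSubfield L))) (x : (cmDatum L N H).Local v),
    MeasurableSpace ((cmDatum L N H).Local v ⧸ Subgroup.centralizer ({x} : Set ((cmDatum L N H).Local v)))]
  (mG : ∀ v : HeightOneSpectrum (𝓞 ↥(maximalRealSubfield L)), OrbitalMeasureFamily ((cmDatum L N H).Local v))
  (mGi : OrbitalMeasureFamily (arch (↥(maximalRealSubfield L)) L (IsCMField.complexConj L) N H))
  (c : ConjClasses (cmDatum L N H).Rational)

omit [∀ g : (cmDatum L N H).Adelic, MeasurableSpace ((cmDatum L N H).Adelic ⧸ Subgroup.centralizer ({g} : Set (cmDatum L N H).Adelic))]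
  [∀ a : arch (↥(maximalRealSubfield L)) L (IsCMField.complexConj L) N H,
    MeasurableSpace (arch (↥(maximalRealSubfield L)) L (IsCMField.complexConj L) N H ⧸
      Subgroup.centralizer ({a} : Set (arch (↥(maximalRealSubfield L)) L (IsCMField.complexConj L) N H)))] in
/-- **Off the exceptional set the local one-point orbit spaces have mass `1`**: if `γ_v = (out c ⊗ 1)_v` is central in `U(H)(L⁺_v)` and the local
family is normalised at `out c ⊗ 1` off `S₀` (★ `IsNormalisedOff`), then `(mG v).atPoint γ_v` is a probability measure for `v ∉ S₀` — the image of
`U(H)(𝒪_v)` in the one-point space `U(H)(L⁺_v) ⧸ C(γ_v)` is everything. [cite: Rogawski1990, §4.3 p. 44] -/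
theorem atPoint_toLocal_univ_eq_one_of_forall_comm {S₀ : Finset (HeightOneSpectrum (𝓞 ↥(maximalRealSubfield L)))}
    (hcenv : ∀ (v : HeightOneSpectrum (𝓞 ↥(maximalRealSubfield L))) (g : (cmDatum L N H).Local v),
      g * (cmDatum L N H).toLocal v ((cmDatum L N H).toAdelic (Quotient.out c)) = (cmDatum L N H).toLocal v ((cmDatum L N H).toAdelic (Quotient.out c)) * g)
    (hS₀ : IsNormalisedOff L N H mG ((cmDatum L N H).toAdelic (Quotient.out c)) S₀)
    (v : HeightOneSpectrum (𝓞 ↥(maximalRealSubfield L))) (hv : v ∉ S₀) :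
    (mG v).atPoint ((cmDatum L N H).toLocal v ((cmDatum L N H).toAdelic (Quotient.out c))) Set.univ = 1 := by
  haveI := subsingleton_quotient_centralizer_of_forall_comm (hcenv v)
  have huniv : ((QuotientGroup.mk : (cmDatum L N H).Local v → (cmDatum L N H).Local v ⧸
        Subgroup.centralizer ({(cmDatum L N H).toLocal v ((cmDatum L N H).toAdelic (Quotient.out c))} : Set ((cmDatum L N H).Local v))) ''
      (cmLocalIntegralLevel L N H v : Set ((cmDatum L N H).Local v))) = Set.univ :=
    Set.eq_univ_of_forall fun y => ⟨1, one_mem _, Subsingleton.elim _ _⟩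
  rw [← huniv]
  exact hS₀ v hv

variable [∀ (v : HeightOneSpectrum (𝓞 ↥(maximalRealSubfield L))) (x : (cmDatum L N H).Local v),
    BorelSpace ((cmDatum L N H).Local v ⧸ Subgroup.centralizer ({x} : Set ((cmDatum L N H).Local v)))]
  [∀ g : (cmDatum L N H).Adelic, BorelSpace ((cmDatum L N H).Adelic ⧸ Subgroup.centralizer ({g} : Set (cmDatum L N H).Adelic))]
  [∀ a : arch (↥(maximalRealSubfield L)) L (IsCMField.complexConj L) N H,
    BorelSpace (arch (↥(maximalRealSubfield L)) L (IsCMField.complexConj L) N H ⧸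
      Subgroup.centralizer ({a} : Set (arch (↥(maximalRealSubfield L)) L (IsCMField.complexConj L) N H)))]

/-- **THE ORBITAL INTEGRAL OF `ofLocal mG mGi` AT A CLASS WITH CENTRAL REPRESENTATIVE.**  At a rational class `c` of `U(H)(L⁺)` whose adelic representative
`γ = out c ⊗ 1` is central in `U(H)(𝔸)` with central local components `γ_v` (the scalar classes `ζ·1`), where the local families are admissible at `⟦γ_v⟧`
and normalised off `S₀` and the archimedean family is admissible at `⟦γ_∞⟧` (binders VERBATIM as ★ `adelicClassOrbitalIntegral_ofLocal_eval_eq_mul_prod`),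
for EVERY test function `F`:
`Φ(γ, F) = adelicClassOrbitalIntegral (ofLocal mG mGi) F c = (mGi.atPoint γ_∞)(univ) · (∏_{v ∈ S₀} ((mG v).atPoint γ_v)(univ)) · F(γ)` — the orbital integrand is
the constant `F γ`, the adelic mass splits `∞ × f` (★ `adelicOrbitalMeasureOfLocal_spec` at `F = 1 · 1`), the finite-adelic mass is the exact Euler product
of the local masses (★ `finAdelicOrbitalMeasureOfLocal_spec` at `f_v ≡ 1`), and those are `1` off `S₀` (`atPoint_toLocal_univ_eq_one_of_forall_comm`).
[cite: Rogawski1990, §5.4 (5.4.3) pp. 72–73; Prop. 10.1.2 (b) p. 146] [cite: Gelbart1975, p. 155 (10.19)] -/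
theorem adelicClassOrbitalIntegral_ofLocal_of_forall_comm {S₀ : Finset (HeightOneSpectrum (𝓞 ↥(maximalRealSubfield L)))}
    (hcen : ∀ g : (cmDatum L N H).Adelic,
      g * (cmDatum L N H).toAdelic (Quotient.out c) = (cmDatum L N H).toAdelic (Quotient.out c) * g)
    (hcenv : ∀ (v : HeightOneSpectrum (𝓞 ↥(maximalRealSubfield L))) (g : (cmDatum L N H).Local v),
      g * (cmDatum L N H).toLocal v ((cmDatum L N H).toAdelic (Quotient.out c)) = (cmDatum L N H).toLocal v ((cmDatum L N H).toAdelic (Quotient.out c)) * g)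
    (hS₀ : IsNormalisedOff L N H mG ((cmDatum L N H).toAdelic (Quotient.out c)) S₀)
    (hadm : ∀ v, mG v (ConjClasses.mk ((cmDatum L N H).toLocal v ((cmDatum L N H).toAdelic (Quotient.out c)))) ≠ 0 ∧
      SMulInvariantMeasure ((cmDatum L N H).Local v) _ (mG v (ConjClasses.mk ((cmDatum L N H).toLocal v ((cmDatum L N H).toAdelic (Quotient.out c))))) ∧
      IsFiniteMeasureOnCompacts (mG v (ConjClasses.mk ((cmDatum L N H).toLocal v ((cmDatum L N H).toAdelic (Quotient.out c))))))
    (hadmA : mGi (ConjClasses.mk (archPart (↥(maximalRealSubfield L)) L (IsCMField.complexConj L) N H ((cmDatum L N H).toAdelic (Quotient.out c)))) ≠ 0 ∧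
      SMulInvariantMeasure (arch (↥(maximalRealSubfield L)) L (IsCMField.complexConj L) N H) _
        (mGi (ConjClasses.mk (archPart (↥(maximalRealSubfield L)) L (IsCMField.complexConj L) N H ((cmDatum L N H).toAdelic (Quotient.out c))))) ∧
      IsFiniteMeasureOnCompacts (mGi (ConjClasses.mk (archPart (↥(maximalRealSubfield L)) L (IsCMField.complexConj L) N H ((cmDatum L N H).toAdelic (Quotient.out c))))))
    (F : (cmDatum L N H).Adelic → ℂ) :
    adelicClassOrbitalIntegral L N H (AdelicOrbitalMeasureFamily.ofLocal L N H mG mGi) F c =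
      ((mGi.atPoint (archPart (↥(maximalRealSubfield L)) L (IsCMField.complexConj L) N H ((cmDatum L N H).toAdelic (Quotient.out c))) Set.univ).toReal : ℂ) *
        (∏ v ∈ S₀, (((mG v).atPoint ((cmDatum L N H).toLocal v ((cmDatum L N H).toAdelic (Quotient.out c))) Set.univ).toReal : ℂ)) *
          F ((cmDatum L N H).toAdelic (Quotient.out c)) := by
  classical
  letI : MeasurableSpace (finAdelic (↥(maximalRealSubfield L)) L (IsCMField.complexConj L) N H ⧸
      Subgroup.centralizer ({finPart (↥(maximalRealSubfield L)) L (IsCMField.complexConj L) N H ((cmDatum L N H).toAdelic (Quotient.out c))} :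
        Set (finAdelic (↥(maximalRealSubfield L)) L (IsCMField.complexConj L) N H))) := borel _
  haveI : BorelSpace (finAdelic (↥(maximalRealSubfield L)) L (IsCMField.complexConj L) N H ⧸
      Subgroup.centralizer ({finPart (↥(maximalRealSubfield L)) L (IsCMField.complexConj L) N H ((cmDatum L N H).toAdelic (Quotient.out c))} :
        Set (finAdelic (↥(maximalRealSubfield L)) L (IsCMField.complexConj L) N H))) := ⟨rfl⟩
  haveI : ∀ v, SMulInvariantMeasure ((cmDatum L N H).Local v) _ (mG v (ConjClasses.mk ((cmDatum L N H).toLocal v ((cmDatum L N H).toAdelic (Quotient.out c))))) :=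
    fun v => (hadm v).2.1
  haveI : ∀ v, IsFiniteMeasureOnCompacts (mG v (ConjClasses.mk ((cmDatum L N H).toLocal v ((cmDatum L N H).toAdelic (Quotient.out c))))) :=
    fun v => (hadm v).2.2
  haveI : ∀ v, SMulInvariantMeasure ((cmDatum L N H).Local v) _ ((mG v).atPoint ((cmDatum L N H).toLocal v ((cmDatum L N H).toAdelic (Quotient.out c)))) :=
    fun v => (mG v).smulInvariantMeasure_atPoint _
  haveI : ∀ v, IsFiniteMeasureOnCompacts ((mG v).atPoint ((cmDatum L N H).toLocal v ((cmDatum L N H).toAdelic (Quotient.out c)))) :=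
    fun v => (mG v).isFiniteMeasureOnCompacts_atPoint _
  haveI := hadmA.2.1
  haveI := hadmA.2.2
  haveI : SMulInvariantMeasure (arch (↥(maximalRealSubfield L)) L (IsCMField.complexConj L) N H) _
      (mGi.atPoint (archPart (↥(maximalRealSubfield L)) L (IsCMField.complexConj L) N H ((cmDatum L N H).toAdelic (Quotient.out c)))) :=
    mGi.smulInvariantMeasure_atPoint _
  haveI : IsFiniteMeasureOnCompacts (mGi.atPoint (archPart (↥(maximalRealSubfield L)) L (IsCMField.complexConj L) N H ((cmDatum L N H).toAdelic (Quotient.out c)))) :=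
    mGi.isFiniteMeasureOnCompacts_atPoint _
  haveI : SFinite (mGi.atPoint (archPart (↥(maximalRealSubfield L)) L (IsCMField.complexConj L) N H ((cmDatum L N H).toAdelic (Quotient.out c)))) := by
    haveI : IsLocallyFiniteMeasure (mGi.atPoint (archPart (↥(maximalRealSubfield L)) L (IsCMField.complexConj L) N H ((cmDatum L N H).toAdelic (Quotient.out c)))) :=
      isLocallyFiniteMeasure_of_isFiniteMeasureOnCompacts
    haveI : SigmaFinite (mGi.atPoint (archPart (↥(maximalRealSubfield L)) L (IsCMField.complexConj L) N H ((cmDatum L N H).toAdelic (Quotient.out c)))) :=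
      sigmaFinite_of_locallyFinite
    infer_instance
  have hne : ∀ v, (mG v).atPoint ((cmDatum L N H).toLocal v ((cmDatum L N H).toAdelic (Quotient.out c))) ≠ 0 :=
    fun v => (mG v).atPoint_ne_zero _ (hadm v).1
  -- the finite part of the central representative is central (`finPart` is onto)
  have hcenf : ∀ g : finAdelic (↥(maximalRealSubfield L)) L (IsCMField.complexConj L) N H,
      g * finPart (↥(maximalRealSubfield L)) L (IsCMField.complexConj L) N H ((cmDatum L N H).toAdelic (Quotient.out c)) =
        finPart (↥(maximalRealSubfield L)) L (IsCMField.complexConj L) N H ((cmDatum L N H).toAdelic (Quotient.out c)) * g := by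
    intro g
    obtain ⟨x, rfl⟩ := finPart_surjective (↥(maximalRealSubfield L)) L (IsCMField.complexConj L) N H g
    -- `x` lives in the generic datum `adelicGroupData L⁺ L c N H`, definitionally `cmDatum L N H` (★ `adelicGroupData_eq_cmDatum`)
    rw [← map_mul, ← map_mul]
    exact congrArg _ (hcen x)
  -- the finite-adelic orbit space is one point, hence compact: the finite-adelic orbital measure is finite
  haveI hsub : Subsingleton (finAdelic (↥(maximalRealSubfield L)) L (IsCMField.complexConj L) N H ⧸
      Subgroup.centralizer ({finPart (↥(maximalRealSubfield L)) L (IsCMField.complexConj L) N H ((cmDatum L N H).toAdelic (Quotient.out c))} :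
        Set (finAdelic (↥(maximalRealSubfield L)) L (IsCMField.complexConj L) N H))) :=
    subsingleton_quotient_centralizer_of_forall_comm hcenf
  have hfinspec := finAdelicOrbitalMeasureOfLocal_spec L N H ((cmDatum L N H).toAdelic (Quotient.out c))
    (fun v => (mG v).atPoint ((cmDatum L N H).toLocal v ((cmDatum L N H).toAdelic (Quotient.out c)))) hS₀ (fun v _ => hne v)
  haveI := hfinspec.2.1
  haveI : IsFiniteMeasure (finAdelicOrbitalMeasureOfLocal L N H ((cmDatum L N H).toAdelic (Quotient.out c))
      (fun v => (mG v).atPoint ((cmDatum L N H).toLocal v ((cmDatum L N H).toAdelic (Quotient.out c)))) S₀) :=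
    CompactSpace.isFiniteMeasure
  -- integrality of `γ_f` off a finite set
  obtain ⟨Sh, hSh⟩ := Literature.MeasureTheory.RestrictedProduct.exists_finset_forall_not_mem_apply_mem
    (fun v => localInt L (IsCMField.complexConj L) N H v)
    (finAdelicEquiv (↥(maximalRealSubfield L)) L (IsCMField.complexConj L) N H
      (finPart (↥(maximalRealSubfield L)) L (IsCMField.complexConj L) N H ((cmDatum L N H).toAdelic (Quotient.out c))))
  -- the orbital integrand of the constant `1` is the constant `1`, integrable on the finite orbit space
  have hInt : Integrable (descConj (finPart (↥(maximalRealSubfield L)) L (IsCMField.complexConj L) N H ((cmDatum L N H).toAdelic (Quotient.out c)))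
      (Subgroup.centralizer ({finPart (↥(maximalRealSubfield L)) L (IsCMField.complexConj L) N H ((cmDatum L N H).toAdelic (Quotient.out c))} :
        Set (finAdelic (↥(maximalRealSubfield L)) L (IsCMField.complexConj L) N H)))
      (centralizer_comm _) (fun _ => (1 : ℂ)))
      (finAdelicOrbitalMeasureOfLocal L N H ((cmDatum L N H).toAdelic (Quotient.out c))
        (fun v => (mG v).atPoint ((cmDatum L N H).toLocal v ((cmDatum L N H).toAdelic (Quotient.out c)))) S₀) := by
    have hc1 : descConj (finPart (↥(maximalRealSubfield L)) L (IsCMField.complexConj L) N H ((cmDatum L N H).toAdelic (Quotient.out c)))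
        (Subgroup.centralizer ({finPart (↥(maximalRealSubfield L)) L (IsCMField.complexConj L) N H ((cmDatum L N H).toAdelic (Quotient.out c))} :
          Set (finAdelic (↥(maximalRealSubfield L)) L (IsCMField.complexConj L) N H)))
        (centralizer_comm _) (fun _ => (1 : ℂ)) = fun _ => 1 := by
      funext y
      induction y using QuotientGroup.induction_on with
      | H g => rw [descConj_mk]
    rw [hc1]
    exact integrable_const _
  -- the finite-adelic mass is the product over `S₀` of the local masses (all `1` off `S₀`)
  have hfin := (hfinspec.2.2.2.2 (fun _ _ => (1 : ℂ)) (fun _ => (1 : ℂ)) (S₀ ∪ Sh)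
    (fun S _ b _ => Finset.prod_const_one.symm) (fun v hv => hSh v fun h' => hv (Finset.mem_union_right _ h'))
    Finset.subset_union_left hInt).2 S₀ (fun v hv => by
      rw [localOrbitalIntegral, orbitalIntegral_const_fun, atPoint_toLocal_univ_eq_one_of_forall_comm L N H mG c hcenv hS₀ v hv,
        ENNReal.toReal_one, one_smul])
  -- the adelic mass splits `∞ × f`
  have hsplit := (adelicOrbitalMeasureOfLocal_spec L N H ((cmDatum L N H).toAdelic (Quotient.out c))
    (mGi.atPoint (archPart (↥(maximalRealSubfield L)) L (IsCMField.complexConj L) N H ((cmDatum L N H).toAdelic (Quotient.out c))))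
    (fun v => (mG v).atPoint ((cmDatum L N H).toLocal v ((cmDatum L N H).toAdelic (Quotient.out c)))) (mGi.atPoint_ne_zero _ hadmA.1) hS₀
    (fun v _ => hne v)).2.2.2 (fun _ => (1 : ℂ)) (fun _ => (1 : ℂ)) (fun _ => (1 : ℂ)) (fun _ => (one_mul (1 : ℂ)).symm)
  rw [hfin] at hsplit
  simp only [localOrbitalIntegral, orbitalIntegral_const_fun, Complex.real_smul, mul_one] at hsplit
  -- assemble
  have heq := AdelicOrbitalMeasureFamily.ofLocal_eq L N H mG mGi c hS₀ hadm
  change orbitalIntegral ((cmDatum L N H).toAdelic (Quotient.out c)) F (AdelicOrbitalMeasureFamily.ofLocal L N H mG mGi c) = _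
  rw [heq, orbitalIntegral_of_forall_comm hcen F, Complex.real_smul, hsplit]

/-- **THE MASS OF `ofLocal mG mGi` AT A CLASS WITH CENTRAL REPRESENTATIVE** (real form): under the binders of
`adelicClassOrbitalIntegral_ofLocal_of_forall_comm`, `(ofLocal mG mGi c univ).toReal = (mGi.atPoint γ_∞ univ).toReal · ∏_{v ∈ S₀} ((mG v).atPoint γ_v univ).toReal`
(the previous theorem at `F ≡ 1`: the orbital integral of `1` is the total mass, ★ `orbitalIntegral_const_fun`). [cite: Rogawski1990, §5.4 (5.4.3) pp. 72–73]
[cite: DeitmarEchterhoff2014, Thm. 1.5.3] -/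
theorem ofLocal_toReal_univ_of_forall_comm {S₀ : Finset (HeightOneSpectrum (𝓞 ↥(maximalRealSubfield L)))}
    (hcen : ∀ g : (cmDatum L N H).Adelic,
      g * (cmDatum L N H).toAdelic (Quotient.out c) = (cmDatum L N H).toAdelic (Quotient.out c) * g)
    (hcenv : ∀ (v : HeightOneSpectrum (𝓞 ↥(maximalRealSubfield L))) (g : (cmDatum L N H).Local v),
      g * (cmDatum L N H).toLocal v ((cmDatum L N H).toAdelic (Quotient.out c)) = (cmDatum L N H).toLocal v ((cmDatum L N H).toAdelic (Quotient.out c)) * g)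
    (hS₀ : IsNormalisedOff L N H mG ((cmDatum L N H).toAdelic (Quotient.out c)) S₀)
    (hadm : ∀ v, mG v (ConjClasses.mk ((cmDatum L N H).toLocal v ((cmDatum L N H).toAdelic (Quotient.out c)))) ≠ 0 ∧
      SMulInvariantMeasure ((cmDatum L N H).Local v) _ (mG v (ConjClasses.mk ((cmDatum L N H).toLocal v ((cmDatum L N H).toAdelic (Quotient.out c))))) ∧
      IsFiniteMeasureOnCompacts (mG v (ConjClasses.mk ((cmDatum L N H).toLocal v ((cmDatum L N H).toAdelic (Quotient.out c))))))
    (hadmA : mGi (ConjClasses.mk (archPart (↥(maximalRealSubfield L)) L (IsCMField.complexConj L) N H ((cmDatum L N H).toAdelic (Quotient.out c)))) ≠ 0 ∧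
      SMulInvariantMeasure (arch (↥(maximalRealSubfield L)) L (IsCMField.complexConj L) N H) _
        (mGi (ConjClasses.mk (archPart (↥(maximalRealSubfield L)) L (IsCMField.complexConj L) N H ((cmDatum L N H).toAdelic (Quotient.out c))))) ∧
      IsFiniteMeasureOnCompacts (mGi (ConjClasses.mk (archPart (↥(maximalRealSubfield L)) L (IsCMField.complexConj L) N H ((cmDatum L N H).toAdelic (Quotient.out c)))))) :
    ((AdelicOrbitalMeasureFamily.ofLocal L N H mG mGi c Set.univ).toReal : ℂ) =
      ((mGi.atPoint (archPart (↥(maximalRealSubfield L)) L (IsCMField.complexConj L) N H ((cmDatum L N H).toAdelic (Quotient.out c))) Set.univ).toReal : ℂ) *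
        ∏ v ∈ S₀, (((mG v).atPoint ((cmDatum L N H).toLocal v ((cmDatum L N H).toAdelic (Quotient.out c))) Set.univ).toReal : ℂ) := by
  have h := adelicClassOrbitalIntegral_ofLocal_of_forall_comm L N H mG mGi c hcen hcenv hS₀ hadm hadmA (fun _ => (1 : ℂ))
  rw [mul_one] at h
  have h2 : adelicClassOrbitalIntegral L N H (AdelicOrbitalMeasureFamily.ofLocal L N H mG mGi) (fun _ => (1 : ℂ)) c =
      ((AdelicOrbitalMeasureFamily.ofLocal L N H mG mGi c Set.univ).toReal : ℂ) := by
    change orbitalIntegral ((cmDatum L N H).toAdelic (Quotient.out c)) (fun _ => (1 : ℂ)) (AdelicOrbitalMeasureFamily.ofLocal L N H mG mGi c) = _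
    rw [orbitalIntegral_const_fun, Complex.real_smul, mul_one]
  rw [← h2, h]

/-- **(CEN) — MASS ONE AT A CENTRAL CLASS FOR `ofLocal`**: under the binders of `adelicClassOrbitalIntegral_ofLocal_of_forall_comm`, if the archimedean member
at `γ_∞` and the local members at `γ_v`, `v ∈ S₀`, are PROBABILITY measures (off `S₀` they are automatically, `atPoint_toLocal_univ_eq_one_of_forall_comm`), then
`AdelicOrbitalMeasureFamily.ofLocal L N H mG mGi c univ = 1`.  (The adelic orbit space `U(H)(𝔸) ⧸ C(γ)` is one point, hence compact, and `ofLocal mG mGi c` is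
finite on compacta (★ `ofLocal_admissible`), so its total mass is finite and `toReal` is faithful.)  Print: at `γ = ζ·1` the O-side term is `m(Z G∖G) f(γ)`
with the orbital integral normalised to the point mass. [cite: Rogawski1990, Prop. 10.1.2 (b) p. 146; §5.4 (5.4.3) pp. 72–73] [cite: DeitmarEchterhoff2014, Thm. 1.5.3] -/
theorem ofLocal_univ_eq_one_of_forall_comm {S₀ : Finset (HeightOneSpectrum (𝓞 ↥(maximalRealSubfield L)))}
    (hcen : ∀ g : (cmDatum L N H).Adelic,
      g * (cmDatum L N H).toAdelic (Quotient.out c) = (cmDatum L N H).toAdelic (Quotient.out c) * g)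
    (hcenv : ∀ (v : HeightOneSpectrum (𝓞 ↥(maximalRealSubfield L))) (g : (cmDatum L N H).Local v),
      g * (cmDatum L N H).toLocal v ((cmDatum L N H).toAdelic (Quotient.out c)) = (cmDatum L N H).toLocal v ((cmDatum L N H).toAdelic (Quotient.out c)) * g)
    (hS₀ : IsNormalisedOff L N H mG ((cmDatum L N H).toAdelic (Quotient.out c)) S₀)
    (hadm : ∀ v, mG v (ConjClasses.mk ((cmDatum L N H).toLocal v ((cmDatum L N H).toAdelic (Quotient.out c)))) ≠ 0 ∧
      SMulInvariantMeasure ((cmDatum L N H).Local v) _ (mG v (ConjClasses.mk ((cmDatum L N H).toLocal v ((cmDatum L N H).toAdelic (Quotient.out c))))) ∧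
      IsFiniteMeasureOnCompacts (mG v (ConjClasses.mk ((cmDatum L N H).toLocal v ((cmDatum L N H).toAdelic (Quotient.out c))))))
    (hadmA : mGi (ConjClasses.mk (archPart (↥(maximalRealSubfield L)) L (IsCMField.complexConj L) N H ((cmDatum L N H).toAdelic (Quotient.out c)))) ≠ 0 ∧
      SMulInvariantMeasure (arch (↥(maximalRealSubfield L)) L (IsCMField.complexConj L) N H) _
        (mGi (ConjClasses.mk (archPart (↥(maximalRealSubfield L)) L (IsCMField.complexConj L) N H ((cmDatum L N H).toAdelic (Quotient.out c))))) ∧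
      IsFiniteMeasureOnCompacts (mGi (ConjClasses.mk (archPart (↥(maximalRealSubfield L)) L (IsCMField.complexConj L) N H ((cmDatum L N H).toAdelic (Quotient.out c))))))
    (h1A : mGi.atPoint (archPart (↥(maximalRealSubfield L)) L (IsCMField.complexConj L) N H ((cmDatum L N H).toAdelic (Quotient.out c))) Set.univ = 1)
    (h1 : ∀ v ∈ S₀, (mG v).atPoint ((cmDatum L N H).toLocal v ((cmDatum L N H).toAdelic (Quotient.out c))) Set.univ = 1) :
    AdelicOrbitalMeasureFamily.ofLocal L N H mG mGi c Set.univ = 1 := by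
  have h := ofLocal_toReal_univ_of_forall_comm L N H mG mGi c hcen hcenv hS₀ hadm hadmA
  rw [h1A, Finset.prod_eq_one (fun v hv => by rw [h1 v hv, ENNReal.toReal_one, Complex.ofReal_one]), ENNReal.toReal_one,
    Complex.ofReal_one, mul_one] at h
  -- the adelic orbit space is one point: the admissible `ofLocal` is a finite measure there
  haveI : Subsingleton ((cmDatum L N H).Adelic ⧸ Subgroup.centralizer ({(cmDatum L N H).toAdelic (Quotient.out c)} : Set (cmDatum L N H).Adelic)) :=
    subsingleton_quotient_centralizer_of_forall_comm hcen
  haveI := (AdelicOrbitalMeasureFamily.ofLocal_admissible L N H mG mGi c hS₀ hadm hadmA).2.1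
  haveI : IsFiniteMeasure (AdelicOrbitalMeasureFamily.ofLocal L N H mG mGi c) := CompactSpace.isFiniteMeasure
  have hfin : AdelicOrbitalMeasureFamily.ofLocal L N H mG mGi c Set.univ ≠ ∞ := measure_ne_top _ _
  have hre : (AdelicOrbitalMeasureFamily.ofLocal L N H mG mGi c Set.univ).toReal = 1 := by exact_mod_cast h
  exact (ENNReal.toReal_eq_one_iff _).1 hre

end CentralOfLocal

end UnitaryGroup

end Literature.NumberTheory.Automorphic

/-! ## §2 The scalar rational classes `ζ • 1`: (CEN) of the singular package for any admissible members with probability central members -/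

namespace Literature.NumberTheory.Rogawski1990

open Literature.NumberTheory.Automorphic
open Literature.AlgebraicGeometry.ShimuraVarieties (unitaryGroup)

section Scalar

variable (L : Type) [Field L] [NumberField L] [IsCMField L] (N : ℕ) (H : Matrix (Fin N) (Fin N) L)

/-- A scalar representative `out c = ζ • 1` is central adelically, place by place and at `∞` (★ `cmDatum_toAdelic_comm_of_smul_one`, ★
`cmDatum_toLocal_toAdelic_comm_of_smul_one`, ★ `cmRationalToArch_comm_of_smul_one` through ★ `archPart_cmDatum_toAdelic`). [cite: Rogawski1990, §3.1 p. 19] -/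
theorem forall_comm_of_out_eq_smul_one (c : ConjClasses (UnitaryGroup.cmDatum L N H).Rational) {ζ : L}
    (hζ : (((Quotient.out c : (UnitaryGroup.cmDatum L N H).Rational).val : GL (Fin N) L) : Matrix (Fin N) (Fin N) L) = ζ • (1 : Matrix (Fin N) (Fin N) L)) :
    (∀ g : (UnitaryGroup.cmDatum L N H).Adelic,
        g * (UnitaryGroup.cmDatum L N H).toAdelic (Quotient.out c) = (UnitaryGroup.cmDatum L N H).toAdelic (Quotient.out c) * g) ∧
      (∀ (v : HeightOneSpectrum (𝓞 ↥(maximalRealSubfield L))) (g : (UnitaryGroup.cmDatum L N H).Local v),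
        g * (UnitaryGroup.cmDatum L N H).toLocal v ((UnitaryGroup.cmDatum L N H).toAdelic (Quotient.out c)) =
          (UnitaryGroup.cmDatum L N H).toLocal v ((UnitaryGroup.cmDatum L N H).toAdelic (Quotient.out c)) * g) ∧
      ∀ g : UnitaryGroup.arch (↥(maximalRealSubfield L)) L (IsCMField.complexConj L) N H,
        g * UnitaryGroup.archPart (↥(maximalRealSubfield L)) L (IsCMField.complexConj L) N H ((UnitaryGroup.cmDatum L N H).toAdelic (Quotient.out c)) =
          UnitaryGroup.archPart (↥(maximalRealSubfield L)) L (IsCMField.complexConj L) N H ((UnitaryGroup.cmDatum L N H).toAdelic (Quotient.out c)) * g := by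
  refine ⟨fun g => cmDatum_toAdelic_comm_of_smul_one hζ g, fun v g => cmDatum_toLocal_toAdelic_comm_of_smul_one hζ v g, fun g => ?_⟩
  rw [archPart_cmDatum_toAdelic]
  exact cmRationalToArch_comm_of_smul_one hζ g

variable
  [∀ g : (UnitaryGroup.cmDatum L N H).Adelic, MeasurableSpace ((UnitaryGroup.cmDatum L N H).Adelic ⧸ Subgroup.centralizer ({g} : Set (UnitaryGroup.cmDatum L N H).Adelic))]
  [∀ a : UnitaryGroup.arch (↥(maximalRealSubfield L)) L (IsCMField.complexConj L) N H,
    MeasurableSpace (UnitaryGroup.arch (↥(maximalRealSubfield L)) L (IsCMField.complexConj L) N H ⧸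
      Subgroup.centralizer ({a} : Set (UnitaryGroup.arch (↥(maximalRealSubfield L)) L (IsCMField.complexConj L) N H)))]
  [∀ (v : HeightOneSpectrum (𝓞 ↥(maximalRealSubfield L))) (x : (UnitaryGroup.cmDatum L N H).Local v),
    MeasurableSpace ((UnitaryGroup.cmDatum L N H).Local v ⧸ Subgroup.centralizer ({x} : Set ((UnitaryGroup.cmDatum L N H).Local v)))]
  [∀ (v : HeightOneSpectrum (𝓞 ↥(maximalRealSubfield L))) (x : (UnitaryGroup.cmDatum L N H).Local v),
    BorelSpace ((UnitaryGroup.cmDatum L N H).Local v ⧸ Subgroup.centralizer ({x} : Set ((UnitaryGroup.cmDatum L N H).Local v)))]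
  [∀ g : (UnitaryGroup.cmDatum L N H).Adelic, BorelSpace ((UnitaryGroup.cmDatum L N H).Adelic ⧸ Subgroup.centralizer ({g} : Set (UnitaryGroup.cmDatum L N H).Adelic))]
  [∀ a : UnitaryGroup.arch (↥(maximalRealSubfield L)) L (IsCMField.complexConj L) N H,
    BorelSpace (UnitaryGroup.arch (↥(maximalRealSubfield L)) L (IsCMField.complexConj L) N H ⧸
      Subgroup.centralizer ({a} : Set (UnitaryGroup.arch (↥(maximalRealSubfield L)) L (IsCMField.complexConj L) N H)))]
  (mG : ∀ v : HeightOneSpectrum (𝓞 ↥(maximalRealSubfield L)), OrbitalMeasureFamily ((UnitaryGroup.cmDatum L N H).Local v))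
  (mGi : OrbitalMeasureFamily (UnitaryGroup.arch (↥(maximalRealSubfield L)) L (IsCMField.complexConj L) N H))
  (c : ConjClasses (UnitaryGroup.cmDatum L N H).Rational)

/-- **`Φ(ζ·1, F)` FOR `ofLocal`**: at a scalar class `out c = ζ • 1`, with the local members admissible at `⟦(ζ·1)_v⟧` and normalised off `S₀` and the
archimedean member admissible at `⟦ζ·1 ⊗ 1⟧`:
`adelicClassOrbitalIntegral (ofLocal mG mGi) F c = (mGi.atPoint γ_∞ univ).toReal · ∏_{v ∈ S₀} ((mG v).atPoint γ_v univ).toReal · F(ζ·1 ⊗ 1)`.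
[cite: Rogawski1990, Prop. 10.1.2 (b) p. 146; §5.4 (5.4.3) pp. 72–73] -/
theorem adelicClassOrbitalIntegral_ofLocal_of_eq_smul_one {ζ : L} {S₀ : Finset (HeightOneSpectrum (𝓞 ↥(maximalRealSubfield L)))}
    (hζ : (((Quotient.out c : (UnitaryGroup.cmDatum L N H).Rational).val : GL (Fin N) L) : Matrix (Fin N) (Fin N) L) = ζ • (1 : Matrix (Fin N) (Fin N) L))
    (hS₀ : UnitaryGroup.IsNormalisedOff L N H mG ((UnitaryGroup.cmDatum L N H).toAdelic (Quotient.out c)) S₀)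
    (hadm : ∀ v, mG v (ConjClasses.mk ((UnitaryGroup.cmDatum L N H).toLocal v ((UnitaryGroup.cmDatum L N H).toAdelic (Quotient.out c)))) ≠ 0 ∧
      SMulInvariantMeasure ((UnitaryGroup.cmDatum L N H).Local v) _
        (mG v (ConjClasses.mk ((UnitaryGroup.cmDatum L N H).toLocal v ((UnitaryGroup.cmDatum L N H).toAdelic (Quotient.out c))))) ∧
      IsFiniteMeasureOnCompacts (mG v (ConjClasses.mk ((UnitaryGroup.cmDatum L N H).toLocal v ((UnitaryGroup.cmDatum L N H).toAdelic (Quotient.out c))))))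
    (hadmA : mGi (ConjClasses.mk (UnitaryGroup.archPart (↥(maximalRealSubfield L)) L (IsCMField.complexConj L) N H ((UnitaryGroup.cmDatum L N H).toAdelic (Quotient.out c)))) ≠ 0 ∧
      SMulInvariantMeasure (UnitaryGroup.arch (↥(maximalRealSubfield L)) L (IsCMField.complexConj L) N H) _
        (mGi (ConjClasses.mk (UnitaryGroup.archPart (↥(maximalRealSubfield L)) L (IsCMField.complexConj L) N H ((UnitaryGroup.cmDatum L N H).toAdelic (Quotient.out c))))) ∧
      IsFiniteMeasureOnCompacts
        (mGi (ConjClasses.mk (UnitaryGroup.archPart (↥(maximalRealSubfield L)) L (IsCMField.complexConj L) N H ((UnitaryGroup.cmDatum L N H).toAdelic (Quotient.out c))))))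
    (F : (UnitaryGroup.cmDatum L N H).Adelic → ℂ) :
    UnitaryGroup.adelicClassOrbitalIntegral L N H (UnitaryGroup.AdelicOrbitalMeasureFamily.ofLocal L N H mG mGi) F c =
      ((mGi.atPoint (UnitaryGroup.archPart (↥(maximalRealSubfield L)) L (IsCMField.complexConj L) N H ((UnitaryGroup.cmDatum L N H).toAdelic (Quotient.out c))) Set.univ).toReal : ℂ) *
        (∏ v ∈ S₀, (((mG v).atPoint ((UnitaryGroup.cmDatum L N H).toLocal v ((UnitaryGroup.cmDatum L N H).toAdelic (Quotient.out c))) Set.univ).toReal : ℂ)) *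
          F ((UnitaryGroup.cmDatum L N H).toAdelic (Quotient.out c)) :=
  UnitaryGroup.adelicClassOrbitalIntegral_ofLocal_of_forall_comm L N H mG mGi c (forall_comm_of_out_eq_smul_one L N H c hζ).1
    (forall_comm_of_out_eq_smul_one L N H c hζ).2.1 hS₀ hadm hadmA F

/-- **THE (CEN) CLAUSE OF ★ `SingularEllipticTransfer[Canonical]` FOR ANY MEMBERS WITH PROBABILITY CENTRAL MEMBERS**: at a scalar class `out c = ζ • 1`, if the
local members are admissible at `⟦(ζ·1)_v⟧` and normalised off `S₀`, the archimedean member is admissible at `⟦ζ·1 ⊗ 1⟧`, and the archimedean member and the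
`S₀`-members have total mass `1` there, then `AdelicOrbitalMeasureFamily.ofLocal L N H mG mGi c univ = 1` — the text of (CEN) (`SingularEllipticTransfer.lean`
:219–:222 at `N = 3`, `H = H′`, `mG = mGs`, `mGi = mGis`). [cite: Rogawski1990, Prop. 10.1.2 (b) p. 146; §14.5 p. 238] [cite: DeitmarEchterhoff2014, Thm. 1.5.3] -/
theorem ofLocal_univ_eq_one_of_eq_smul_one {ζ : L} {S₀ : Finset (HeightOneSpectrum (𝓞 ↥(maximalRealSubfield L)))}
    (hζ : (((Quotient.out c : (UnitaryGroup.cmDatum L N H).Rational).val : GL (Fin N) L) : Matrix (Fin N) (Fin N) L) = ζ • (1 : Matrix (Fin N) (Fin N) L))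
    (hS₀ : UnitaryGroup.IsNormalisedOff L N H mG ((UnitaryGroup.cmDatum L N H).toAdelic (Quotient.out c)) S₀)
    (hadm : ∀ v, mG v (ConjClasses.mk ((UnitaryGroup.cmDatum L N H).toLocal v ((UnitaryGroup.cmDatum L N H).toAdelic (Quotient.out c)))) ≠ 0 ∧
      SMulInvariantMeasure ((UnitaryGroup.cmDatum L N H).Local v) _
        (mG v (ConjClasses.mk ((UnitaryGroup.cmDatum L N H).toLocal v ((UnitaryGroup.cmDatum L N H).toAdelic (Quotient.out c))))) ∧
      IsFiniteMeasureOnCompacts (mG v (ConjClasses.mk ((UnitaryGroup.cmDatum L N H).toLocal v ((UnitaryGroup.cmDatum L N H).toAdelic (Quotient.out c))))))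
    (hadmA : mGi (ConjClasses.mk (UnitaryGroup.archPart (↥(maximalRealSubfield L)) L (IsCMField.complexConj L) N H ((UnitaryGroup.cmDatum L N H).toAdelic (Quotient.out c)))) ≠ 0 ∧
      SMulInvariantMeasure (UnitaryGroup.arch (↥(maximalRealSubfield L)) L (IsCMField.complexConj L) N H) _
        (mGi (ConjClasses.mk (UnitaryGroup.archPart (↥(maximalRealSubfield L)) L (IsCMField.complexConj L) N H ((UnitaryGroup.cmDatum L N H).toAdelic (Quotient.out c))))) ∧
      IsFiniteMeasureOnCompacts
        (mGi (ConjClasses.mk (UnitaryGroup.archPart (↥(maximalRealSubfield L)) L (IsCMField.complexConj L) N H ((UnitaryGroup.cmDatum L N H).toAdelic (Quotient.out c))))))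
    (h1A : mGi.atPoint (UnitaryGroup.archPart (↥(maximalRealSubfield L)) L (IsCMField.complexConj L) N H ((UnitaryGroup.cmDatum L N H).toAdelic (Quotient.out c))) Set.univ = 1)
    (h1 : ∀ v ∈ S₀, (mG v).atPoint ((UnitaryGroup.cmDatum L N H).toLocal v ((UnitaryGroup.cmDatum L N H).toAdelic (Quotient.out c))) Set.univ = 1) :
    UnitaryGroup.AdelicOrbitalMeasureFamily.ofLocal L N H mG mGi c Set.univ = 1 :=
  UnitaryGroup.ofLocal_univ_eq_one_of_forall_comm L N H mG mGi c (forall_comm_of_out_eq_smul_one L N H c hζ).1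
    (forall_comm_of_out_eq_smul_one L N H c hζ).2.1 hS₀ hadm hadmA h1A h1

end Scalar

end Literature.NumberTheory.Rogawski1990

/-! ## §3 (ED. 2) Admissibility at a central class FROM mass one: the P2 stub's exact hypotheses (C1) ∧ (NORM) suffice

The T6-L5 stub `stub_centralMass_one` (draft v1 88621e78, F0P3a-p05 (g8)) carries ONLY (C1) «the local and archimedean members have total mass one at the components
of every scalar rational class» and (NORM); §1–§2 above also asked for admissibility of those members.  At a CENTRAL point admissibility is automatic from
mass one: the orbit space is one point, so every measure on it is invariant, a probability measure is finite on compacta, and it is non-zero.  Hence the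
(CEN) text from `(hζ, hS₀, h1, h1A)` alone — the pen's one-liner. -/

namespace Literature.NumberTheory.Automorphic

section CentralAdmissible

variable {G : Type*} [Group G] [TopologicalSpace G]
  [∀ g : G, MeasurableSpace (G ⧸ Subgroup.centralizer ({g} : Set G))]
  [∀ g : G, BorelSpace (G ⧸ Subgroup.centralizer ({g} : Set G))]

omit [TopologicalSpace G] [∀ g : G, BorelSpace (G ⧸ Subgroup.centralizer ({g} : Set G))] in
/-- **Every measure on the one-point orbit space of a CENTRAL element is `G`-invariant** (the action on a subsingleton is trivial).
[cite: DeitmarEchterhoff2014, Thm. 1.5.3] -/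
theorem smulInvariantMeasure_quotient_centralizer_of_forall_comm {γ : G} (hγ : ∀ g : G, g * γ = γ * g)
    (μ : Measure (G ⧸ Subgroup.centralizer ({γ} : Set G))) : SMulInvariantMeasure G (G ⧸ Subgroup.centralizer ({γ} : Set G)) μ := by
  haveI := subsingleton_quotient_centralizer_of_forall_comm hγ
  refine ⟨fun c s _ => ?_⟩
  have hs : (fun x : G ⧸ Subgroup.centralizer ({γ} : Set G) => c • x) ⁻¹' s = s :=
    Set.ext fun x => by rw [Set.mem_preimage, Subsingleton.elim (c • x) x]
  rw [hs]

/-- **ADMISSIBILITY AT A CENTRAL CLASS FROM MASS ONE**: if `γ` is central and the member of the class-indexed family `m` read at `γ` (★ `OrbitalMeasureFamily.atPoint`)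
is a probability measure, then the member `m ⟦γ⟧` itself is non-zero, `G`-invariant and finite on compacta (the representative `out ⟦γ⟧ = γ` is central, ★
`quotientOut_conjClassesMk_eq_of_forall_comm`; its orbit space is one point, so `atPoint` — a push-forward along a map out of a subsingleton, measurable by
`Subsingleton.measurable` — has the same total mass). [cite: DeitmarEchterhoff2014, Thm. 1.5.3] [cite: Gelbart1975, (9.13)] -/
theorem OrbitalMeasureFamily.admissible_mk_of_atPoint_univ_eq_one_of_forall_comm {γ : G} (hγ : ∀ g : G, g * γ = γ * g) (m : OrbitalMeasureFamily G)
    (h1 : m.atPoint γ Set.univ = 1) :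
    m (ConjClasses.mk γ) ≠ 0 ∧ SMulInvariantMeasure G (G ⧸ Subgroup.centralizer ({(Quotient.out (ConjClasses.mk γ) : G)} : Set G)) (m (ConjClasses.mk γ)) ∧
      IsFiniteMeasureOnCompacts (m (ConjClasses.mk γ)) := by
  have hout : (Quotient.out (ConjClasses.mk γ) : G) = γ := quotientOut_conjClassesMk_eq_of_forall_comm hγ
  have hγ' : ∀ g : G, g * (Quotient.out (ConjClasses.mk γ) : G) = (Quotient.out (ConjClasses.mk γ) : G) * g := by
    rw [hout]; exact hγ
  haveI := subsingleton_quotient_centralizer_of_forall_comm hγ'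
  have hmass : m (ConjClasses.mk γ) Set.univ = 1 := by
    have h := h1
    rw [OrbitalMeasureFamily.atPoint, Measure.map_apply Subsingleton.measurable MeasurableSet.univ, Set.preimage_univ] at h
    exact h
  refine ⟨fun h0 => ?_, smulInvariantMeasure_quotient_centralizer_of_forall_comm hγ' _, ?_⟩
  · rw [h0, Measure.coe_zero, Pi.zero_apply] at hmass
    exact zero_ne_one hmass
  · haveI : IsFiniteMeasure (m (ConjClasses.mk γ)) := ⟨by rw [hmass]; exact ENNReal.one_lt_top⟩
    infer_instance

end CentralAdmissible

end Literature.NumberTheory.Automorphic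

namespace Literature.NumberTheory.Rogawski1990

open Literature.NumberTheory.Automorphic
open Literature.AlgebraicGeometry.ShimuraVarieties (unitaryGroup)

section ScalarMassOne

variable (L : Type) [Field L] [NumberField L] [IsCMField L] (N : ℕ) (H : Matrix (Fin N) (Fin N) L)
  [∀ g : (UnitaryGroup.cmDatum L N H).Adelic, MeasurableSpace ((UnitaryGroup.cmDatum L N H).Adelic ⧸ Subgroup.centralizer ({g} : Set (UnitaryGroup.cmDatum L N H).Adelic))]
  [∀ a : UnitaryGroup.arch (↥(maximalRealSubfield L)) L (IsCMField.complexConj L) N H,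
    MeasurableSpace (UnitaryGroup.arch (↥(maximalRealSubfield L)) L (IsCMField.complexConj L) N H ⧸
      Subgroup.centralizer ({a} : Set (UnitaryGroup.arch (↥(maximalRealSubfield L)) L (IsCMField.complexConj L) N H)))]
  [∀ (v : HeightOneSpectrum (𝓞 ↥(maximalRealSubfield L))) (x : (UnitaryGroup.cmDatum L N H).Local v),
    MeasurableSpace ((UnitaryGroup.cmDatum L N H).Local v ⧸ Subgroup.centralizer ({x} : Set ((UnitaryGroup.cmDatum L N H).Local v)))]
  [∀ (v : HeightOneSpectrum (𝓞 ↥(maximalRealSubfield L))) (x : (UnitaryGroup.cmDatum L N H).Local v),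
    BorelSpace ((UnitaryGroup.cmDatum L N H).Local v ⧸ Subgroup.centralizer ({x} : Set ((UnitaryGroup.cmDatum L N H).Local v)))]
  [∀ g : (UnitaryGroup.cmDatum L N H).Adelic, BorelSpace ((UnitaryGroup.cmDatum L N H).Adelic ⧸ Subgroup.centralizer ({g} : Set (UnitaryGroup.cmDatum L N H).Adelic))]
  [∀ a : UnitaryGroup.arch (↥(maximalRealSubfield L)) L (IsCMField.complexConj L) N H,
    BorelSpace (UnitaryGroup.arch (↥(maximalRealSubfield L)) L (IsCMField.complexConj L) N H ⧸
      Subgroup.centralizer ({a} : Set (UnitaryGroup.arch (↥(maximalRealSubfield L)) L (IsCMField.complexConj L) N H)))]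
  (mG : ∀ v : HeightOneSpectrum (𝓞 ↥(maximalRealSubfield L)), OrbitalMeasureFamily ((UnitaryGroup.cmDatum L N H).Local v))
  (mGi : OrbitalMeasureFamily (UnitaryGroup.arch (↥(maximalRealSubfield L)) L (IsCMField.complexConj L) N H))
  (c : ConjClasses (UnitaryGroup.cmDatum L N H).Rational)

/-- **(CEN) FROM (C1) ∧ (NORM) ALONE — the T6-L5 stub `stub_centralMass_one` at a scalar class, with NO admissibility hypothesis**: at `out c = ζ • 1`, if the
local members are normalised off `S₀` at the class ((NORM)), every local member read at `(ζ·1)_v` is a probability measure and so is the archimedean member at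
`ζ·1 ⊗ 1` ((C1)), then `AdelicOrbitalMeasureFamily.ofLocal L N H mG mGi c univ = 1`.  Admissibility at the central components is automatic
(`OrbitalMeasureFamily.admissible_mk_of_atPoint_univ_eq_one_of_forall_comm` on `U(H)(L⁺_v)` and on `U(H)(L⁺ ⊗ ℝ)`), then ★ `ofLocal_univ_eq_one_of_eq_smul_one`.
The pen's P2 proof: `intro c ⟨ζ, hζ⟩; obtain ⟨S₀, hS₀⟩ := hnorm (out c) (not_isRegularElt_of_coe_eq_smul_one _ hζ); exact ofLocal_univ_eq_one_of_eq_smul_one_of_atPoint_univ_eq_one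
L 3 H′ mGs mGis c hζ hS₀ (hC1 c ⟨ζ, hζ⟩).1 (hC1 c ⟨ζ, hζ⟩).2`. [cite: Rogawski1990, Prop. 10.1.2 (b) p. 146; §14.5 p. 238] [cite: DeitmarEchterhoff2014, Thm. 1.5.3] -/
theorem ofLocal_univ_eq_one_of_eq_smul_one_of_atPoint_univ_eq_one {ζ : L} {S₀ : Finset (HeightOneSpectrum (𝓞 ↥(maximalRealSubfield L)))}
    (hζ : (((Quotient.out c : (UnitaryGroup.cmDatum L N H).Rational).val : GL (Fin N) L) : Matrix (Fin N) (Fin N) L) = ζ • (1 : Matrix (Fin N) (Fin N) L))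
    (hS₀ : UnitaryGroup.IsNormalisedOff L N H mG ((UnitaryGroup.cmDatum L N H).toAdelic (Quotient.out c)) S₀)
    (h1 : ∀ v, (mG v).atPoint ((UnitaryGroup.cmDatum L N H).toLocal v ((UnitaryGroup.cmDatum L N H).toAdelic (Quotient.out c))) Set.univ = 1)
    (h1A : mGi.atPoint (UnitaryGroup.archPart (↥(maximalRealSubfield L)) L (IsCMField.complexConj L) N H ((UnitaryGroup.cmDatum L N H).toAdelic (Quotient.out c))) Set.univ = 1) :
    UnitaryGroup.AdelicOrbitalMeasureFamily.ofLocal L N H mG mGi c Set.univ = 1 := by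
  obtain ⟨-, hcenv, hcenA⟩ := forall_comm_of_out_eq_smul_one L N H c hζ
  exact ofLocal_univ_eq_one_of_eq_smul_one L N H mG mGi c hζ hS₀
    (fun v => (mG v).admissible_mk_of_atPoint_univ_eq_one_of_forall_comm (hcenv v) (h1 v))
    (mGi.admissible_mk_of_atPoint_univ_eq_one_of_forall_comm hcenA h1A) h1A (fun v _ => h1 v)

end ScalarMassOne

end Literature.NumberTheory.Rogawski1990

end
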